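import Literature.MathematicalPhysics.QuantumLattice.HubbardTTPrimeGrandCanonicalEnsembleEquivalence
import Literature.MathematicalPhysics.QuantumLattice.HubbardTTPrimeGrandCanonicalPressureZeeman
import HarnessLib

/-!
# Density and magnetisation brackets from grand-canonical pressures (Griffiths' lemma in `μ` and `h` for the numbers)

Topic `MathematicalPhysics/QuantumLattice` (family `hubbard`); consumer forms of the Legendre dualities
`HubbardTTPrimeGrandCanonicalEnsembleEquivalence.lean` (`P(μ) = sup_n [pressureTT' n + βμn]`, attained at some `μ` for
every interior `n` when `β > 0`) and `HubbardTTPrimeGrandCanonicalPressureZeeman.lean`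
(`P(μ,h) = sup_{x,y} [p(x,y) + βμ(x+y) + βh(x−y)]`). The practical question for grand-canonical certificates (cluster /
high-temperature expansions, KMS relaxations at fixed `μ`) is WHICH filling a chemical potential addresses. Answer, in
numbers only: if the density `n` attains the Legendre supremum at `μ` (`pressureTT' n + βμn = P(μ)`), then for any
`μ₁ < μ < μ₂`

`(P(μ) − P(μ₁))/(μ − μ₁) ≤ β n ≤ (P(μ₂) − P(μ))/(μ₂ − μ)`

(`slope_le_mul_density_of_legendre_eq`, `mul_density_le_slope_of_legendre_eq`; supporting-line form for every `μ'`: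
`gcPressureTT'_sub_le_of_legendre_eq`; certificate forms `mul_density_le_of_gc_bounds`, `le_mul_density_of_gc_bounds`;
existence of such a `μ` for every interior `n` at `β > 0`: `exists_chemicalPotential_slope`) — three certified
grand-canonical pressures bracket the filling. The Zeeman twins bracket the filling `x + y` and the magnetisation `x − y`
of a spin-density pair attaining `P(μ, h)` by pressures at neighbouring `μ` resp. `h`
(`gcPressureTT'Zeeman_sub_le_of_legendre_eq_mu`, `gcPressureTT'Zeeman_sub_le_of_legendre_eq_field`).

Everything is PROVED; no definition, no named fact.

## Mathlib / tree search

REUSED: `pressureTT'_add_le_gcPressureTT'`, `exists_chemicalPotential_pressureTT'_eq` (`…EnsembleEquivalence`),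
`pressureTT'₂_add_le_gcPressureTT'Zeeman` (`…Zeeman`). The `T > 0` state analogue (thermal docc / density of torus-limit
Gibbs states from pressure slopes) is `HubbardTTPrimeThermalPressureSlopes`; here everything is at the level of the numbers.
`lean search 'density.*gcPressure|legendre_eq'`: nothing (2026-08-27).

## References

* R. B. Griffiths, J. Math. Phys. 5 (1964) 1215 (convexity ⇒ derivative brackets); D. Ruelle, *Statistical Mechanics:
  Rigorous Results* (1969), §3.4. [cite: Ruelle1969, §3.4]
* R. B. Israel, *Convexity in the Theory of Lattice Gases* (1979), Thm. I.2.4. [cite: Israel1979, Thm. I.2.4]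
-/

noncomputable section

namespace Literature.MathematicalPhysics.QuantumLattice

open Matrix Finset HubbardWave0 Literature.Probability.LatticeModels LiebThm1
open _root_.Filter
open scoped _root_.Topology ComplexOrder BigOperators

namespace ThermodynamicLimit

section Density

variable {β : ℝ} (hβ : 0 ≤ β) (t t' : ℝ) {U : ℝ} (hU : 0 ≤ U)
include hβ hU

/-- **Right bracket**: if `n` attains the Legendre supremum at `μ` then for every `μ₂ > μ`,
`β n ≤ (P(μ₂) − P(μ))/(μ₂ − μ)`. [cite: Ruelle1969, §3.4] -/
theorem mul_density_le_slope_of_legendre_eq {μ μ₂ n : ℝ} (hn0 : 0 ≤ n) (hn2 : n < 2) (hμ : μ < μ₂)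
    (heq : pressureTT' β t t' U n + β * μ * n = gcPressureTT' β t t' U μ) :
    β * n ≤ (gcPressureTT' β t t' U μ₂ - gcPressureTT' β t t' U μ) / (μ₂ - μ) := by
  have h2 := pressureTT'_add_le_gcPressureTT' hβ t t' hU μ₂ hn0 hn2
  rw [le_div_iff₀ (sub_pos.2 hμ)]
  nlinarith [h2, heq]

/-- **Left bracket**: if `n` attains the Legendre supremum at `μ` then for every `μ₁ < μ`,
`(P(μ) − P(μ₁))/(μ − μ₁) ≤ β n`. [cite: Ruelle1969, §3.4] -/
theorem slope_le_mul_density_of_legendre_eq {μ₁ μ n : ℝ} (hn0 : 0 ≤ n) (hn2 : n < 2) (hμ : μ₁ < μ)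
    (heq : pressureTT' β t t' U n + β * μ * n = gcPressureTT' β t t' U μ) :
    (gcPressureTT' β t t' U μ - gcPressureTT' β t t' U μ₁) / (μ - μ₁) ≤ β * n := by
  have h1 := pressureTT'_add_le_gcPressureTT' hβ t t' hU μ₁ hn0 hn2
  rw [div_le_iff₀ (sub_pos.2 hμ)]
  nlinarith [h1, heq]

/-- **Certificate form, density from above**: a grand-canonical FLOOR `W ≤ P(μ)` and CEILING `P(μ₂) ≤ q₂` at `μ₂ > μ`
give `β n ≤ (q₂ − W)/(μ₂ − μ)` for every density `n` attaining the supremum at `μ`. [cite: Ruelle1969, §3.4] -/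
theorem mul_density_le_of_gc_bounds {μ μ₂ n W q₂ : ℝ} (hn0 : 0 ≤ n) (hn2 : n < 2) (hμ : μ < μ₂)
    (heq : pressureTT' β t t' U n + β * μ * n = gcPressureTT' β t t' U μ)
    (hW : W ≤ gcPressureTT' β t t' U μ) (hq : gcPressureTT' β t t' U μ₂ ≤ q₂) :
    β * n ≤ (q₂ - W) / (μ₂ - μ) := by
  have h := mul_density_le_slope_of_legendre_eq hβ t t' hU hn0 hn2 hμ heq
  refine h.trans (div_le_div_of_nonneg_right (by linarith) (sub_pos.2 hμ).le)

/-- **Certificate form, density from below**: with the supremum attained at `μ` by `n` and a grand-canonical CEILING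
`P(μ₁) ≤ q₁` at some `μ₁ < μ`: `(pressureTT' n + βμn − q₁)/(μ − μ₁) ≤ β n` (any certified canonical floor on
`pressureTT' n` then makes the left side a number). [cite: Ruelle1969, §3.4] -/
theorem le_mul_density_of_gc_bounds {μ₁ μ n q₁ : ℝ} (hn0 : 0 ≤ n) (hn2 : n < 2) (hμ : μ₁ < μ)
    (heq : pressureTT' β t t' U n + β * μ * n = gcPressureTT' β t t' U μ)
    (hq : gcPressureTT' β t t' U μ₁ ≤ q₁) :
    (pressureTT' β t t' U n + β * μ * n - q₁) / (μ - μ₁) ≤ β * n := by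
  have h := slope_le_mul_density_of_legendre_eq hβ t t' hU hn0 hn2 hμ heq
  refine le_trans (div_le_div_of_nonneg_right (by linarith) (sub_pos.2 hμ).le) h

/-- **Supporting-line form** (no ordering needed): if `pressureTT' n + βμn = P(μ)` then for EVERY `μ'`,
`P(μ) − P(μ') ≤ β n (μ − μ')` — the affine function `μ' ↦ P(μ) + βn(μ' − μ)` supports the convex `P` at `μ` with slope
`βn`; both brackets above are this inequality divided by `μ − μ'` of either sign. [cite: Ruelle1969, §3.4] -/
theorem gcPressureTT'_sub_le_of_legendre_eq {μ n : ℝ} (μ' : ℝ) (hn0 : 0 ≤ n) (hn2 : n < 2)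
    (heq : pressureTT' β t t' U n + β * μ * n = gcPressureTT' β t t' U μ) :
    gcPressureTT' β t t' U μ - gcPressureTT' β t t' U μ' ≤ β * n * (μ - μ') := by
  have h := pressureTT'_add_le_gcPressureTT' hβ t t' hU μ' hn0 hn2
  linarith

/-- **Every interior density has a chemical potential, which is a slope of `P`** (`β > 0`, `0 < n < 2`):
`∃ μ, pressureTT' n + βμn = P(μ) ∧ ∀ μ', P(μ) − P(μ') ≤ βn(μ − μ')`. [cite: Ruelle1969, §3.4] [cite: Israel1979, Thm. I.2.4] -/
theorem exists_chemicalPotential_slope (hβ' : 0 < β) {n : ℝ} (hn0 : 0 < n) (hn2 : n < 2) :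
    ∃ μ : ℝ, pressureTT' β t t' U n + β * μ * n = gcPressureTT' β t t' U μ ∧
      ∀ μ' : ℝ, gcPressureTT' β t t' U μ - gcPressureTT' β t t' U μ' ≤ β * n * (μ - μ') := by
  obtain ⟨μ, hμ⟩ := exists_chemicalPotential_pressureTT'_eq hβ t t' hU hβ' hn0 hn2
  have heq : pressureTT' β t t' U n + β * μ * n = gcPressureTT' β t t' U μ := by linarith
  exact ⟨μ, heq, fun μ' => gcPressureTT'_sub_le_of_legendre_eq hβ t t' hU μ' hn0.le hn2 heq⟩

end Density

section Zeeman

variable {β : ℝ} (hβ : 0 ≤ β) (t t' : ℝ) {U : ℝ} (hU : 0 ≤ U)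
include hβ hU

/-- **Filling slope in a field** (no ordering needed): if `(x, y)` attains the Zeeman supremum at `(μ, h)` then for
every `μ'`, `P(μ,h) − P(μ',h) ≤ β(x+y)(μ − μ')` — dividing by `μ − μ'` of either sign brackets the filling `x + y` by
two Zeeman pressures at neighbouring chemical potentials. [cite: Ruelle1969, §3.4] -/
theorem gcPressureTT'Zeeman_sub_le_of_legendre_eq_mu {μ hz x y : ℝ} (μ' : ℝ) (hx0 : 0 ≤ x) (hx1 : x < 1) (hy0 : 0 ≤ y)
    (hy1 : y < 1)
    (heq : pressureTT'₂ β t t' U x y + (β * μ * (x + y) + β * hz * (x - y)) = gcPressureTT'Zeeman β t t' U μ hz) :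
    gcPressureTT'Zeeman β t t' U μ hz - gcPressureTT'Zeeman β t t' U μ' hz ≤ β * (x + y) * (μ - μ') := by
  have a := pressureTT'₂_add_le_gcPressureTT'Zeeman hβ t t' hU μ' hz hx0 hx1 hy0 hy1
  linarith

/-- **Magnetisation slope**: if `(x, y)` attains the Zeeman supremum at `(μ, h)` then for every `h'`,
`P(μ,h) − P(μ,h') ≤ β(x−y)(h − h')` — two certified Zeeman pressures at neighbouring fields bracket the magnetisation
`n↑ − n↓`. [cite: Ruelle1969, §3.4] -/
theorem gcPressureTT'Zeeman_sub_le_of_legendre_eq_field {μ hz x y : ℝ} (hz' : ℝ) (hx0 : 0 ≤ x) (hx1 : x < 1) (hy0 : 0 ≤ y)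
    (hy1 : y < 1)
    (heq : pressureTT'₂ β t t' U x y + (β * μ * (x + y) + β * hz * (x - y)) = gcPressureTT'Zeeman β t t' U μ hz) :
    gcPressureTT'Zeeman β t t' U μ hz - gcPressureTT'Zeeman β t t' U μ hz' ≤ β * (x - y) * (hz - hz') := by
  have a := pressureTT'₂_add_le_gcPressureTT'Zeeman hβ t t' hU μ hz' hx0 hx1 hy0 hy1
  linarith

end Zeeman

end ThermodynamicLimit

end Literature.MathematicalPhysics.QuantumLattice
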